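import Literature.MathematicalPhysics.QuantumLattice.ApproximateEigenvectorLemmas
import HarnessLib

/-!
# Coordinates along orthonormal families: vectors `a ᵥ* F` and two-particle matrices `Fᵀ Y G`

Trunk T-QLATTICE (certified finite-cluster computations). A kernel-checked certificate for a
two-particle quantity of a finite cluster — a residual `‖A − (H Y + Y Hᵀ − E Y)‖_F` of Kato's
reduced resolvent of `H ⊗ 1 + 1 ⊗ H` (Kato 1966, I-§5.3; the "sum over intermediate states" of
Tsai–Kivelson 2006, App. A), a Frobenius pairing `⟨A', Y⟩_F`, a norm `‖Y‖_F` — is evaluated on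
COORDINATE ARRAYS, while the statement lives on the cluster's Fock space. This file is the
dictionary, for two finite families of vectors written as the ROWS of matrices
`F : Matrix ι m ℂ`, `G : Matrix κ m ℂ` with orthonormal rows (`Σ_s conj F_{Is} F_{I's} = δ_{II'}`):

* one particle: the vector with coordinates `a` is `a ᵥ* F = Σ_I a_I F_I`; inner products and norms
  are those of the coordinates (`star_vecMul_dotProduct_vecMul`, `eucNorm_vecMul_sq`);
* two particles: the matrix with coordinate array `Y : Matrix ι κ ℂ` is `Fᵀ * Y * G`
  (`= Σ_{IJ} Y_{IJ} F_I G_Jᵀ`, `transpose_mul_mul_apply`); rank-one matrices of coordinate vectors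
  are `Fᵀ (a bᵀ) G` (`vecMulVec_vecMul`); Frobenius pairings and norms are those of the arrays
  (`matPairing_coords`, `eucNorm_coords_sq`); if `H Fᵀ = Fᵀ h₁` and `H Gᵀ = Gᵀ h₂` (the families
  span invariant subspaces on which `H` acts by the matrices `h₁`, `h₂`) then
  `H (Fᵀ Y G) = Fᵀ (h₁ Y) G` and `(Fᵀ Y G) Hᵀ = Fᵀ (Y h₂ᵀ) G` (`mul_coords`, `coords_mul_transpose`),
  so the Sylvester residual of `Y` is `Fᵀ (A − (h₁ Y + Y h₂ᵀ − E Y)) G` (`sylvesterResidual_coords`);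
* supports: if the rows of `F` vanish off `p₁` and those of `G` off `p₂`, then `Fᵀ Y G` vanishes
  off `p₁ × p₂` and equals its truncation to the block (`coords_support`, `trunc_coords`).

Everything is finite-dimensional matrix algebra (associativity, `trace`-free index bookkeeping);
no definition and no named fact is introduced.

References: T. Kato, *Perturbation theory for linear operators* (1966), I-§5.3 [Kato1966];
W.-F. Tsai, S. A. Kivelson, PRB 73 (2006) 214510, App. A [TsaiKivelson2006].
-/

noncomputable section

namespace Literature.MathematicalPhysics.QuantumLattice

open Matrix Finset

namespace RowCoords

variable {m ι κ : Type*} [Fintype m] [Fintype ι] [Fintype κ] [DecidableEq ι] [DecidableEq κ]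

/-! ### One particle -/

omit [Fintype m] [DecidableEq ι] [DecidableEq κ] in
/-- The vector with coordinates `a` along the rows of `F`: `(a ᵥ* F) s = Σ_I a_I F_{Is}`. [folklore] -/
theorem vecMul_apply' (a : ι → ℂ) (F : Matrix ι m ℂ) (s : m) : (a ᵥ* F) s = ∑ I, a I * F I s := rfl

omit [DecidableEq κ] in
/-- **Inner products in coordinates**: for orthonormal rows,
`⟨a ᵥ* F, b ᵥ* F⟩ = Σ_I conj a_I b_I`. [folklore] -/
theorem star_vecMul_dotProduct_vecMul (F : Matrix ι m ℂ)
    (hF : ∀ I I', star (F I) ⬝ᵥ F I' = if I = I' then 1 else 0) (a b : ι → ℂ) :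
    star (a ᵥ* F) ⬝ᵥ (b ᵥ* F) = ∑ I, star (a I) * b I := by
  classical
  have hF' : ∀ I I', ∑ s, star (F I s) * F I' s = if I = I' then 1 else 0 := fun I I' => hF I I'
  calc star (a ᵥ* F) ⬝ᵥ (b ᵥ* F)
      = ∑ s, (∑ I, star (a I) * star (F I s)) * ∑ I', b I' * F I' s := by
        simp only [dotProduct, Pi.star_apply, vecMul_apply', star_sum, star_mul']
    _ = ∑ s, ∑ I, ∑ I', star (a I) * b I' * (star (F I s) * F I' s) := by
        refine Finset.sum_congr rfl fun s _ => ?_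
        rw [Finset.sum_mul_sum]
        refine Finset.sum_congr rfl fun I _ => Finset.sum_congr rfl fun I' _ => ?_
        ring
    _ = ∑ I, ∑ I', star (a I) * b I' * ∑ s, star (F I s) * F I' s := by
        rw [Finset.sum_comm]
        refine Finset.sum_congr rfl fun I _ => ?_
        rw [Finset.sum_comm]
        refine Finset.sum_congr rfl fun I' _ => ?_
        rw [Finset.mul_sum]
    _ = ∑ I, star (a I) * b I := by
        refine Finset.sum_congr rfl fun I _ => ?_
        simp only [hF', mul_ite, mul_one, mul_zero]
        rw [Finset.sum_ite_eq univ I, if_pos (mem_univ _)]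

omit [DecidableEq κ] in
/-- **Norms in coordinates**: `‖a ᵥ* F‖² = Σ_I |a_I|²` for orthonormal rows. [folklore] -/
theorem eucNorm_vecMul_sq (F : Matrix ι m ℂ)
    (hF : ∀ I I', star (F I) ⬝ᵥ F I' = if I = I' then 1 else 0) (a : ι → ℂ) :
    eucNorm (a ᵥ* F) ^ 2 = ∑ I, ‖a I‖ ^ 2 := by
  rw [eucNorm_sq, star_vecMul_dotProduct_vecMul F hF, Complex.re_sum]
  refine Finset.sum_congr rfl fun I _ => ?_
  rw [Complex.star_def, Complex.conj_mul', ← Complex.ofReal_pow, Complex.ofReal_re]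

omit [Fintype m] [DecidableEq ι] [DecidableEq κ] in
/-- A vector along rows supported on `p` is supported on `p`. [folklore] -/
theorem vecMul_support (F : Matrix ι m ℂ) (p : m → Prop) (hF : ∀ I s, ¬ p s → F I s = 0)
    (a : ι → ℂ) : ∀ s, ¬ p s → (a ᵥ* F) s = 0 := fun s hs => by
  rw [vecMul_apply']
  exact Finset.sum_eq_zero fun I _ => by rw [hF I s hs, mul_zero]

/-! ### Two particles -/

omit [Fintype m] [DecidableEq ι] [DecidableEq κ] in
/-- Entries of the two-particle matrix with coordinate array `Y`:
`(Fᵀ Y G)_{st} = Σ_{I J} F_{Is} Y_{IJ} G_{Jt}`. [folklore] -/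
theorem transpose_mul_mul_apply (F : Matrix ι m ℂ) (G : Matrix κ m ℂ) (Y : Matrix ι κ ℂ) (s t : m) :
    (Fᵀ * Y * G) s t = ∑ I, ∑ J, F I s * Y I J * G J t := by
  rw [Matrix.mul_apply]
  simp only [Matrix.mul_apply, transpose_apply, Finset.sum_mul]
  rw [Finset.sum_comm]

omit [Fintype m] [DecidableEq ι] [DecidableEq κ] in
/-- **Rank-one matrices of coordinate vectors**: `(a ᵥ* F)(b ᵥ* G)ᵀ = Fᵀ (a bᵀ) G`. [folklore] -/
theorem vecMulVec_vecMul (F : Matrix ι m ℂ) (G : Matrix κ m ℂ) (a : ι → ℂ) (b : κ → ℂ) :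
    vecMulVec (a ᵥ* F) (b ᵥ* G) = Fᵀ * vecMulVec a b * G := by
  ext s t
  rw [vecMulVec_apply, transpose_mul_mul_apply, vecMul_apply', vecMul_apply', Finset.sum_mul_sum]
  refine Finset.sum_congr rfl fun I _ => Finset.sum_congr rfl fun J _ => ?_
  rw [vecMulVec_apply]
  ring

omit [Fintype m] [DecidableEq ι] [DecidableEq κ] in
/-- `Fᵀ Y G` is additive in `Y`. [folklore] -/
theorem coords_add (F : Matrix ι m ℂ) (G : Matrix κ m ℂ) (Y Y' : Matrix ι κ ℂ) :
    Fᵀ * (Y + Y') * G = Fᵀ * Y * G + Fᵀ * Y' * G := by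
  rw [Matrix.mul_add, Matrix.add_mul]

omit [Fintype m] [DecidableEq ι] [DecidableEq κ] in
/-- `Fᵀ Y G` is compatible with subtraction. [folklore] -/
theorem coords_sub (F : Matrix ι m ℂ) (G : Matrix κ m ℂ) (Y Y' : Matrix ι κ ℂ) :
    Fᵀ * (Y - Y') * G = Fᵀ * Y * G - Fᵀ * Y' * G := by
  rw [Matrix.mul_sub, Matrix.sub_mul]

omit [Fintype m] [DecidableEq ι] [DecidableEq κ] in
/-- `Fᵀ Y G` is homogeneous in `Y`. [folklore] -/
theorem coords_smul (F : Matrix ι m ℂ) (G : Matrix κ m ℂ) (c : ℂ) (Y : Matrix ι κ ℂ) :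
    Fᵀ * (c • Y) * G = c • (Fᵀ * Y * G) := by
  rw [Matrix.mul_smul, Matrix.smul_mul]

omit [Fintype m] [DecidableEq ι] [DecidableEq κ] in
/-- `Fᵀ Y G` of a finite sum. [folklore] -/
theorem coords_sum {β : Type*} (S : Finset β) (F : Matrix ι m ℂ) (G : Matrix κ m ℂ) (Y : β → Matrix ι κ ℂ) :
    Fᵀ * (∑ k ∈ S, Y k) * G = ∑ k ∈ S, Fᵀ * Y k * G := by
  rw [Matrix.mul_sum, Matrix.sum_mul]

omit [DecidableEq ι] [DecidableEq κ] in
/-- **The action of `H` in coordinates (left factor)**: if `H Fᵀ = Fᵀ h₁` then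
`H (Fᵀ Y G) = Fᵀ (h₁ Y) G`. [folklore] -/
theorem mul_coords {H : Matrix m m ℂ} {F : Matrix ι m ℂ} {h₁ : Matrix ι ι ℂ} (hHF : H * Fᵀ = Fᵀ * h₁)
    (G : Matrix κ m ℂ) (Y : Matrix ι κ ℂ) : H * (Fᵀ * Y * G) = Fᵀ * (h₁ * Y) * G := by
  rw [← Matrix.mul_assoc, ← Matrix.mul_assoc, hHF, Matrix.mul_assoc Fᵀ h₁ Y]

omit [DecidableEq ι] [DecidableEq κ] in
/-- **The action of `H` in coordinates (right factor)**: if `H Gᵀ = Gᵀ h₂` then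
`(Fᵀ Y G) Hᵀ = Fᵀ (Y h₂ᵀ) G`. [folklore] -/
theorem coords_mul_transpose {H : Matrix m m ℂ} (F : Matrix ι m ℂ) {G : Matrix κ m ℂ} {h₂ : Matrix κ κ ℂ}
    (hHG : H * Gᵀ = Gᵀ * h₂) (Y : Matrix ι κ ℂ) : (Fᵀ * Y * G) * Hᵀ = Fᵀ * (Y * h₂ᵀ) * G := by
  have hGH : G * Hᵀ = h₂ᵀ * G := by
    have := congrArg Matrix.transpose hHG
    rwa [transpose_mul, transpose_transpose, transpose_mul, transpose_transpose] at this
  rw [Matrix.mul_assoc, hGH, ← Matrix.mul_assoc, Matrix.mul_assoc Fᵀ Y h₂ᵀ]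

omit [DecidableEq ι] [DecidableEq κ] in
/-- **The Sylvester residual in coordinates**: with `H Fᵀ = Fᵀ h₁`, `H Gᵀ = Gᵀ h₂`,
`Fᵀ A G − (H (Fᵀ Y G) + (Fᵀ Y G) Hᵀ − E • Fᵀ Y G) = Fᵀ (A − (h₁ Y + Y h₂ᵀ − E • Y)) G`. [folklore] -/
theorem sylvesterResidual_coords {H : Matrix m m ℂ} {F : Matrix ι m ℂ} {G : Matrix κ m ℂ} {h₁ : Matrix ι ι ℂ}
    {h₂ : Matrix κ κ ℂ} (hHF : H * Fᵀ = Fᵀ * h₁) (hHG : H * Gᵀ = Gᵀ * h₂) (A Y : Matrix ι κ ℂ) (E : ℂ) :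
    Fᵀ * A * G - (H * (Fᵀ * Y * G) + (Fᵀ * Y * G) * Hᵀ - E • (Fᵀ * Y * G)) =
      Fᵀ * (A - (h₁ * Y + Y * h₂ᵀ - E • Y)) * G := by
  rw [mul_coords hHF, coords_mul_transpose F hHG, coords_sub, coords_sub, coords_add, coords_smul]

/-- **Frobenius pairings in coordinates**: for orthonormal rows of `F` and of `G`,
`Σ_{st} conj (Fᵀ Y G)_{st} (Fᵀ Y' G)_{st} = Σ_{IJ} conj Y_{IJ} Y'_{IJ}`. [folklore] -/
theorem matPairing_coords (F : Matrix ι m ℂ) (G : Matrix κ m ℂ)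
    (hF : ∀ I I', star (F I) ⬝ᵥ F I' = if I = I' then 1 else 0)
    (hG : ∀ J J', star (G J) ⬝ᵥ G J' = if J = J' then 1 else 0) (Y Y' : Matrix ι κ ℂ) :
    ∑ s, ∑ t, star ((Fᵀ * Y * G) s t) * (Fᵀ * Y' * G) s t = ∑ I, ∑ J, star (Y I J) * Y' I J := by
  classical
  -- write both two-particle matrices through their rows in `t`: `(Fᵀ Y G) s · = (row s) ᵥ* G`
  have hrow : ∀ (Z : Matrix ι κ ℂ) (s : m), (fun t => (Fᵀ * Z * G) s t) = (fun J => (Fᵀ * Z) s J) ᵥ* G := by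
    intro Z s; funext t; rw [Matrix.mul_apply]; rfl
  have h1 : ∀ s, ∑ t, star ((Fᵀ * Y * G) s t) * (Fᵀ * Y' * G) s t =
      ∑ J, star ((Fᵀ * Y) s J) * (Fᵀ * Y') s J := by
    intro s
    have := star_vecMul_dotProduct_vecMul G hG (fun J => (Fᵀ * Y) s J) (fun J => (Fᵀ * Y') s J)
    rw [← hrow Y s, ← hrow Y' s] at this
    simpa [dotProduct] using this
  simp only [h1]
  rw [Finset.sum_comm]
  -- now the columns in `s`: `(Fᵀ Z) · J = (col J of Z) ᵥ* F`
  have hcol : ∀ (Z : Matrix ι κ ℂ) (J : κ), (fun s => (Fᵀ * Z) s J) = (fun I => Z I J) ᵥ* F := by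
    intro Z J; funext s
    rw [Matrix.mul_apply, vecMul_apply']
    exact Finset.sum_congr rfl fun I _ => by rw [transpose_apply, mul_comm]
  have h2 : ∀ J, ∑ s, star ((Fᵀ * Y) s J) * (Fᵀ * Y') s J = ∑ I, star (Y I J) * Y' I J := by
    intro J
    have := star_vecMul_dotProduct_vecMul F hF (fun I => Y I J) (fun I => Y' I J)
    rw [← hcol Y J, ← hcol Y' J] at this
    simpa [dotProduct] using this
  simp only [h2]
  rw [Finset.sum_comm]

/-- **Frobenius norms in coordinates**: `‖Fᵀ Y G‖_F² = Σ_{IJ} |Y_{IJ}|²`. [folklore] -/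
theorem eucNorm_coords_sq (F : Matrix ι m ℂ) (G : Matrix κ m ℂ)
    (hF : ∀ I I', star (F I) ⬝ᵥ F I' = if I = I' then 1 else 0)
    (hG : ∀ J J', star (G J) ⬝ᵥ G J' = if J = J' then 1 else 0) (Y : Matrix ι κ ℂ) :
    eucNorm (fun st : m × m => (Fᵀ * Y * G) st.1 st.2) ^ 2 = ∑ I, ∑ J, ‖Y I J‖ ^ 2 := by
  rw [eucNorm_sq, dotProduct, Fintype.sum_prod_type]
  change (∑ s, ∑ t, star ((Fᵀ * Y * G) s t) * (Fᵀ * Y * G) s t).re = _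
  rw [matPairing_coords F G hF hG, Complex.re_sum]
  refine Finset.sum_congr rfl fun I _ => ?_
  rw [Complex.re_sum]
  refine Finset.sum_congr rfl fun J _ => ?_
  rw [Complex.star_def, Complex.conj_mul', ← Complex.ofReal_pow, Complex.ofReal_re]

/-- The Frobenius norm in coordinates, non-squared form with a rational bound: if `Σ |Y_{IJ}|² ≤ r²` and
`0 ≤ r` then `‖Fᵀ Y G‖_F ≤ r`. [folklore] -/
theorem eucNorm_coords_le (F : Matrix ι m ℂ) (G : Matrix κ m ℂ)
    (hF : ∀ I I', star (F I) ⬝ᵥ F I' = if I = I' then 1 else 0)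
    (hG : ∀ J J', star (G J) ⬝ᵥ G J' = if J = J' then 1 else 0) (Y : Matrix ι κ ℂ) {r : ℝ} (hr : 0 ≤ r)
    (h : ∑ I, ∑ J, ‖Y I J‖ ^ 2 ≤ r ^ 2) :
    eucNorm (fun st : m × m => (Fᵀ * Y * G) st.1 st.2) ≤ r := by
  rw [← eucNorm_coords_sq F G hF hG] at h
  exact (pow_le_pow_iff_left₀ (eucNorm_nonneg _) hr two_ne_zero).1 h

omit [Fintype m] [DecidableEq ι] [DecidableEq κ] in
/-- **Supports**: rows of `F` vanishing off `p₁` and rows of `G` vanishing off `p₂` make `Fᵀ Y G` vanish off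
`p₁ × p₂`. [folklore] -/
theorem coords_support (F : Matrix ι m ℂ) (G : Matrix κ m ℂ) (p₁ p₂ : m → Prop)
    (hF : ∀ I s, ¬ p₁ s → F I s = 0) (hG : ∀ J t, ¬ p₂ t → G J t = 0) (Y : Matrix ι κ ℂ) :
    ∀ s t, ¬ (p₁ s ∧ p₂ t) → (Fᵀ * Y * G) s t = 0 := by
  intro s t hst
  rw [transpose_mul_mul_apply]
  refine Finset.sum_eq_zero fun I _ => Finset.sum_eq_zero fun J _ => ?_
  by_cases hs : p₁ s
  · rw [hG J t (fun ht => hst ⟨hs, ht⟩), mul_zero]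
  · rw [hF I s hs, zero_mul, zero_mul]

omit [Fintype m] [DecidableEq ι] [DecidableEq κ] in
/-- The truncation to `p₁ × p₂` of a supported two-particle matrix is the matrix itself. [folklore] -/
theorem trunc_coords (F : Matrix ι m ℂ) (G : Matrix κ m ℂ) (p₁ p₂ : m → Prop) [DecidablePred p₁]
    [DecidablePred p₂] (hF : ∀ I s, ¬ p₁ s → F I s = 0) (hG : ∀ J t, ¬ p₂ t → G J t = 0) (Y : Matrix ι κ ℂ) :
    (Matrix.of fun s t => if p₁ s ∧ p₂ t then (Fᵀ * Y * G) s t else 0) = Fᵀ * Y * G := by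
  ext s t
  rw [Matrix.of_apply]
  split_ifs with hst
  · rfl
  · exact (coords_support F G p₁ p₂ hF hG Y s t hst).symm

end RowCoords

end Literature.MathematicalPhysics.QuantumLattice
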